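import Mathlib
import Summits.NavierStokesRegularity.NavierStokesRegularity.Theorems.TypeIQuarterGateResidualBelowTypeIAncientLiouville
import Summits.NavierStokesRegularity.NavierStokesRegularity.Theorems.ExtremalTypeIConstantSelfSimilarExcluded
import Summits.NavierStokesRegularity.NavierStokesRegularity.Theorems.ExtremalTypeIConstantSmallConstantLiouville
import HarnessLib

/-!
# `TypeIQuarterGate`: CLOSED SUB-CASES of the re-typed residual TQAL, by name from the landed rungs of
# route `ExtremalTypeIConstant` — exactly self-similar flows (item 8219) and small constants (item 8218)

Helper file for crux `ParabolicGaldiLiouville` (stmt-NavierStokesRegularity-0893) of route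
`TypeIQuarterGate` (theorems only, no definitions). By
`QuarterZoomTypeIClock.isTypeIAncientMild_of_typeIClock` the TQAL class (bounded ancient mild, smooth,
bounded slice enstrophy, `L⁶` slices, clock `√(−s)‖v(s,y)‖ ≤ C'`) lies in the KNSS-gauge Type-I class
`IsTypeIAncientMild C'`; the PROVED support items of route `ExtremalTypeIConstant` then close two
sub-cases of TQAL by name:

* `typeIClockLiouville_selfSimilar_subcase` — item 8219 `SelfSimilarExcluded`
  (`extremalTypeIConstant_selfSimilarExcluded_proof`; Tsai 1998 / Nečas–Růžička–Šverák 1996 via the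
  tree's bounded-profile theorem): a TQAL-class flow which is exactly backward self-similar about some
  `(x₁, 0)` (generator `∇v(t)·(a + x) + v + 2t ∂ₜv = 0`) vanishes.
* `typeIClockLiouville_smallConstant_subcase` — item 8218 `SmallConstantLiouville`
  (`extremalTypeIConstant_smallConstantLiouville_proof`; explicit `c₀ = 1/(πκ)`): a TQAL-class flow
  with clock constant `C' < c₀` vanishes (same regime as `typeIClockLiouville_small_clock`, here by the
  item's name and constant).

What stays OPEN of TQAL: non-self-similar Type-I-clocked flows with large clock constant in Galdi's
parabolic class (the discretely self-similar case included: Bradshaw–Tsai Open Problem 5.1 /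
Chae–Wolf). HONEST FRAMING: rungs of an open residual; nothing here bears on Navier–Stokes regularity.
References: Tsai 1998 Thm 1; KNSS 2009 §6; Chae–Wolf 2017 §3.
-/

noncomputable section

set_option linter.dupNamespace false

namespace Summit.NavierStokesRegularity.NavierStokesRegularity.Theorems

open Set MeasureTheory Filter Topology Function
open scoped ENNReal NNReal
open Literature.Analysis.FluidPDE
open QuarterZoomTypeIClock

/-- **TQAL, exactly self-similar sub-case — CLOSED** (item 8219 `ExtremalTypeIConstant.SelfSimilarExcluded`
by name): a bounded ancient mild solution (`ν = 1`), smooth, with bounded slice enstrophy, `L⁶` slices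
and the clock `√(−s)‖v(s,y)‖ ≤ C'`, which is exactly backward self-similar about some `(x₁, 0)`
(`∇v(t)(x)(a + x) + v(t,x) + 2t·∂ₜv(t,x) = 0` for all `t < 0`, `x`), vanishes identically.
[cite: Tsai1998, Thm 1] [cite: KochNadirashviliSereginSverak2009, §6] -/
theorem typeIClockLiouville_selfSimilar_subcase
    (v : ℝ → EuclideanSpace ℝ (Fin 3) → EuclideanSpace ℝ (Fin 3))
    (hv : IsBoundedAncientMildSolution 1 v)
    (hsm : ContDiffOn ℝ (⊤ : ℕ∞) (Function.uncurry v) (Set.Iio 0 ×ˢ Set.univ))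
    (hens : ∃ C : NNReal, ∀ s < 0,
      ∫⁻ y, ENNReal.ofReal (frobeniusNormSq (fderiv ℝ (v s) y)) ≤ C)
    (hL6 : ∀ s < 0, MemLp (v s) 6 volume)
    (hclock : ∃ C' : ℝ, 0 ≤ C' ∧ ∀ s < 0, ∀ y, Real.sqrt (-s) * ‖v s y‖ ≤ C')
    (hss : ∃ a : EuclideanSpace ℝ (Fin 3), ∀ t < 0, ∀ x,
      fderiv ℝ (v t) x (a + x) + v t x + (2 * t) • timeDeriv v t x = 0) :
    ∀ t < 0, ∀ x, v t x = 0 := by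
  obtain ⟨C', -, hcl⟩ := hclock
  have hT : IsTypeIAncientMild C' v := isTypeIAncientMild_of_typeIClock hv hsm hens hL6 hcl
  exact extremalTypeIConstant_selfSimilarExcluded_proof C' v (isTypeIAncientMild_iff.1 hT) hss

/-- **TQAL, small-constant sub-case — CLOSED** (item 8218 `ExtremalTypeIConstant.SmallConstantLiouville`
by name, with its constant `c₀`): a bounded ancient mild solution (`ν = 1`), smooth, with bounded slice
enstrophy, `L⁶` slices and a clock `√(−s)‖v(s,y)‖ ≤ C'` with `C' < c₀` vanishes identically.
[cite: ChaeWolf2017RemovingDSS, §3 Step 1] [cite: KochNadirashviliSereginSverak2009, §4] -/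
theorem typeIClockLiouville_smallConstant_subcase :
    ∃ c₀ : ℝ, 0 < c₀ ∧ ∀ (C' : ℝ) (v : ℝ → EuclideanSpace ℝ (Fin 3) → EuclideanSpace ℝ (Fin 3)),
      IsBoundedAncientMildSolution 1 v →
      ContDiffOn ℝ (⊤ : ℕ∞) (Function.uncurry v) (Set.Iio 0 ×ˢ Set.univ) →
      (∃ C : NNReal, ∀ s < 0,
        ∫⁻ y, ENNReal.ofReal (frobeniusNormSq (fderiv ℝ (v s) y)) ≤ C) →
      (∀ s < 0, MemLp (v s) 6 volume) →
      (∀ s < 0, ∀ y, Real.sqrt (-s) * ‖v s y‖ ≤ C') → C' < c₀ →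
      ∀ t < 0, ∀ x, v t x = 0 := by
  obtain ⟨c₀, hc₀, hsmall⟩ := extremalTypeIConstant_smallConstantLiouville_proof
  refine ⟨c₀, hc₀, fun C' v hv hsm hens hL6 hcl hlt => ?_⟩
  have hT : IsTypeIAncientMild C' v := isTypeIAncientMild_of_typeIClock hv hsm hens hL6 hcl
  exact hsmall C' v (isTypeIAncientMild_iff.1 hT) hlt

end Summit.NavierStokesRegularity.NavierStokesRegularity.Theorems

end
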